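import Literature.Probability.LatticeModels.CurrentValueLaw
import Literature.Probability.LatticeModels.CurrentsTraceLaw
import HarnessLib

/-!
# The laws of the box currents capped at `2`, on the space of capped bond configurations

Topic `Probability/LatticeModels`, namespace `Literature.Probability.LatticeModels`; theorems and
plain definitions only. This is the finite-volume layer of the construction of the infinite-volume
**single** random currents `P⁰_{ℤ^d,β}`, `P⁺_{ℤ^d,β}` and of the law of the sum `n₁ + n₂` of two
independent ones, needed for

* A. Raoufi, *Translation-invariant Gibbs states of the Ising model: general setting*, Ann.
  Probab. **48** (2020) 760–777 (arXiv:1710.07608), Thm. 2 ("there exist two measures `P⁰_{G,β}`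
  and `P⁺_{G,β}` on `Ω_G` such that `P⁰` is the weak limit of `P_{Λ_n,β}` and `P⁺` is the weak
  limit of `P_{Λ_n∪δ,β}`") and §3 (the events `A_{xy} = {n_{xy} = 1, …}`, `U(n)`, and the law
  `P⁰ ⊗ P⁺` of `n₁ + n₂`; bib key `Raoufi2020`),

following the finite-volume conventions of the tree for the double current of
Aizenman–Duminil-Copin–Sidoravicius, CMP 334 (2015) (`DoubleCurrents.lean`: ghost-free box graphs
`freeBoxGraph d L ≤ plusBoxGraph d L` on `↥Λ_{L+1}`, sources constrained in `Λ_L = boxCore d L`,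
`adsDoubleCurrentLaw d L β` = the law of the trace of `n₁ + n₂`).

**The capped encoding.** Every event of Raoufi's §3 is a function of the values of the current
capped at `2` (`n_e = 0`, `n_e = 1`, `n_e ≥ 2`: the trace, the condition `n_{xy} = 1` of `A_{xy}`,
and "two paths sharing an edge `e` need `n_e ≥ 2`"). We therefore record a current `n` on the
lattice bonds by the **capped configuration** `capEnc n = {(e, ff) | n_e ≥ 1} ∪ {(e, tt) | n_e ≥ 2}`,
a subset of `Sym2 (Site d) × Bool` (`CapConfig d`), so that the tree's configuration-space
machinery on `Set ι` (local events, local limits, zero–one laws: `PercolationEvents.lean`,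
`LocalLimitMeasure.lean`) applies verbatim; `capTrace ω = {e | (e,ff) ∈ ω}` recovers the trace and
`capDouble ω = {e | (e,tt) ∈ ω}` the doubled bonds.

## Contents

* `Current.liftVal n : Sym2 (Site d) → ℕ` — the value of a box current read on lattice bonds
  (`0` off the box graph); `liftVal_map`, `one_le_liftVal_iff` (trace), `liftVal_add`.
* `plusCapLaw d L β`, `freeCapLaw d L β` — the laws of `capEnc (liftVal n)` for the sourceless
  `+` / free currents of `Λ_L` (weights `𝟙[∂n ∩ Λ_L = ∅] w_β(n) / Z`, as `plusCurrentSum`), and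
  `sumCapLaw d L β` — the law of `capEnc (liftVal n₁ + liftVal n₂)` under the pair weights
  `adsPairWeight d L β` of the tree (Raoufi's `P_{Λ} ⊗ P_{Λ∪δ}`, ADS15 (3.1)); all three are
  probability measures for `β ≥ 0` and are explicit countable sums of Dirac masses
  (`*_real_apply`).
* `sumCapLaw_map_capTrace` — **the trace of the summed law is the tree's double current**
  `adsDoubleCurrentLaw d L β`.
* `capCyl S A₁ A₂` — the cylinder "on the bonds of `S`, `n ≥ 1` exactly on `A₁` and `n ≥ 2`
  exactly on `A₂`"; it is the tree's `localCylinder` over `S ×ˢ univ` (`capCyl_eq_localCylinder`);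
  the value cylinders `{n = 𝟙_{S₁} on S}` of `CurrentValueLaw.lean` are `capCyl S S₁ ∅`, and
  `plusCapLaw_real_valCyl` / `freeCapLaw_real_valCyl` identify their probabilities with
  `plusCurrentValProb` / `freeCurrentValProb`.
* `indicator_capCyl_eq_sum` — **inclusion–exclusion** `𝟙[n ≥ 2] = 1 - 𝟙[n = 0] - 𝟙[n = 1]`:
  the indicator of `capCyl S A₁ A₂` (`A₂ ⊆ A₁ ⊆ S`) is
  `∑_{T ⊆ A₂} ∑_{T₁ ⊆ T} (-1)^{|T|} 𝟙[n = 𝟙_{(A₁∖A₂) ∪ T₁} on (S ∖ A₂) ∪ T]`, whence the capped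
  cylinder probabilities as signed sums of value-cylinder probabilities
  (`plusCapLaw_real_capCyl_eq_sum`, `freeCapLaw_real_capCyl_eq_sum`);
* `indicator_capCyl_add_eq_sum`, `sumCapLaw_real_capCyl_eq_sum` — **the summed law factorises**
  on capped cylinders: `𝟙[cap(k₁+k₂) = (A₁,A₂) on S]` is the sum over the pairs of patterns
  `(B₁,B₂)`, `(C₁,C₂)` with `B₁ ∪ C₁ = A₁`, `B₂ ∪ C₂ ∪ (B₁ ∩ C₁) = A₂` of the products of
  indicators, so `sumCapLaw[capCyl] = ∑ freeCapLaw[capCyl] · plusCapLaw[capCyl]` (Raoufi's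
  `P⁰ ⊗ P⁺`, ADS15 (3.1), at the level of capped values).

## Mathlib status

No random currents in Mathlib. Anchors: `Measure.sum`, `Measure.dirac`,
`Measure.sum_apply_of_countable`, `ENNReal.tsum_toReal_eq`, `ENNReal.ofReal_tsum_of_nonneg`,
`Finset.prod_one_add`-type expansions (`Finset.prod_add`), `Summable.tsum_finsetSum`,
`tsum_mul_tsum_of_summable_norm`; tree: `Current`, `Current.traced`, `plusCurrentSum`,
`plusCurrentSumVal`, `plusCurrentValProb`, `adsPairWeight`, `adsPairNorm`, `adsDoubleCurrentLaw`,
`liftBonds`, `boxBonds`, `localCylinder`, `IsLocalEvent`.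
-/

noncomputable section

open MeasureTheory Finset Filter Topology Literature.Probability.Percolation
open scoped symmDiff ENNReal

namespace Literature.Probability.LatticeModels

variable (d : ℕ)

/-! ### Capped configurations -/

/-- **Capped bond configurations**: subsets of `Sym2 (Site d) × Bool`; `(e, ff)` records
`n_e ≥ 1` and `(e, tt)` records `n_e ≥ 2` for a current `n` (the information on `n` capped at the
value `2`, which is all that the events of Raoufi 2020, §3 use). [cite: Raoufi2020, §2 and §3] -/
abbrev CapConfig : Type := Set (Sym2 (Site d) × Bool)

variable {d}

/-- **The capped encoding** of an `ℕ`-valued bond function: `(e, b) ∈ capEnc k ↔ b.toNat + 1 ≤ k e`,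
i.e. `(e, ff) ∈ capEnc k ↔ 1 ≤ k e` and `(e, tt) ∈ capEnc k ↔ 2 ≤ k e`. [cite: Raoufi2020, §2 and §3] -/
def capEnc (k : Sym2 (Site d) → ℕ) : CapConfig d := {p | p.2.toNat + 1 ≤ k p.1}

/-- Membership in the capped encoding. [folklore] -/
theorem mem_capEnc_iff (k : Sym2 (Site d) → ℕ) (p : Sym2 (Site d) × Bool) :
    p ∈ capEnc k ↔ p.2.toNat + 1 ≤ k p.1 := Iff.rfl

/-- `(e, ff) ∈ capEnc k ↔ 1 ≤ k e`. [folklore] -/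
@[simp] theorem mk_false_mem_capEnc_iff (k : Sym2 (Site d) → ℕ) (e : Sym2 (Site d)) :
    (e, false) ∈ capEnc k ↔ 1 ≤ k e := by
  simp [mem_capEnc_iff]

/-- `(e, tt) ∈ capEnc k ↔ 2 ≤ k e`. [folklore] -/
@[simp] theorem mk_true_mem_capEnc_iff (k : Sym2 (Site d) → ℕ) (e : Sym2 (Site d)) :
    (e, true) ∈ capEnc k ↔ 2 ≤ k e := by
  simp [mem_capEnc_iff]

/-- **The trace** of a capped configuration: the bonds `e` with `(e, ff) ∈ ω` (`n_e ≥ 1`). [cite: Raoufi2020, §2] -/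
def capTrace (ω : CapConfig d) : BondConfig (Site d) := {e | (e, false) ∈ ω}

/-- **The doubled bonds** of a capped configuration: the bonds `e` with `(e, tt) ∈ ω` (`n_e ≥ 2`). [cite: Raoufi2020, §3] -/
def capDouble (ω : CapConfig d) : BondConfig (Site d) := {e | (e, true) ∈ ω}

/-- Membership in the trace. [folklore] -/
@[simp] theorem mem_capTrace_iff (ω : CapConfig d) (e : Sym2 (Site d)) : e ∈ capTrace ω ↔ (e, false) ∈ ω :=
  Iff.rfl

/-- Membership in the doubled bonds. [folklore] -/
@[simp] theorem mem_capDouble_iff (ω : CapConfig d) (e : Sym2 (Site d)) : e ∈ capDouble ω ↔ (e, true) ∈ ω :=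
  Iff.rfl

/-- The trace of an encoded function is its support. [folklore] -/
theorem capTrace_capEnc (k : Sym2 (Site d) → ℕ) : capTrace (capEnc k) = {e | 1 ≤ k e} := by
  ext e; simp

/-- The doubled bonds of an encoded function are the bonds of value `≥ 2`. [folklore] -/
theorem capDouble_capEnc (k : Sym2 (Site d) → ℕ) : capDouble (capEnc k) = {e | 2 ≤ k e} := by
  ext e; simp

/-- Doubled bonds of an encoded function are in its trace. [folklore] -/
theorem capDouble_capEnc_subset_capTrace (k : Sym2 (Site d) → ℕ) : capDouble (capEnc k) ⊆ capTrace (capEnc k) := by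
  intro e he
  rw [capDouble_capEnc, Set.mem_setOf_eq] at he
  rw [capTrace_capEnc, Set.mem_setOf_eq]
  omega

/-- The trace map is measurable. [folklore] -/
theorem measurable_capTrace : Measurable (capTrace (d := d)) :=
  measurable_set_iff.2 fun e => measurable_set_mem (e, false)

/-- The doubled-bonds map is measurable. [folklore] -/
theorem measurable_capDouble : Measurable (capDouble (d := d)) :=
  measurable_set_iff.2 fun e => measurable_set_mem (e, true)

/-! ### Reading a box current on the lattice bonds -/

section LiftVal

variable {L : ℕ} {G : SimpleGraph (BoxVertex d L)} [DecidableRel G.Adj]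

/-- **The value of a box current on a lattice bond**: `n_e` if the bond is the image of the edge
`e` of the box graph, `0` otherwise (written as a sum over the at most one edge over the bond). [folklore] -/
def Current.liftVal (n : Current G) : Sym2 (Site d) → ℕ := fun s =>
  ∑ e ∈ univ.filter (fun e : G.edgeFinset => Sym2.map Subtype.val (e : Sym2 (BoxVertex d L)) = s), n e

/-- At most one edge of the box graph lies over a given bond. [folklore] -/
theorem filter_map_eq_eq_singleton (e : G.edgeFinset) :
    univ.filter (fun e' : G.edgeFinset => Sym2.map Subtype.val (e' : Sym2 (BoxVertex d L)) =
      Sym2.map Subtype.val (e : Sym2 (BoxVertex d L))) = {e} := by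
  ext e'
  simp only [Finset.mem_filter, Finset.mem_univ, true_and, Finset.mem_singleton]
  constructor
  · intro h
    exact Subtype.ext (Sym2.map.injective Subtype.val_injective h)
  · rintro rfl; rfl

/-- The lifted value over an edge of the box graph is the value of the current. [folklore] -/
@[simp] theorem Current.liftVal_map (n : Current G) (e : G.edgeFinset) :
    n.liftVal (Sym2.map Subtype.val (e : Sym2 (BoxVertex d L))) = n e := by
  rw [Current.liftVal, filter_map_eq_eq_singleton, Finset.sum_singleton]

/-- The lifted value vanishes off the images of the edges. [folklore] -/
theorem Current.liftVal_eq_zero (n : Current G) {s : Sym2 (Site d)}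
    (hs : ∀ e : G.edgeFinset, Sym2.map Subtype.val (e : Sym2 (BoxVertex d L)) ≠ s) : n.liftVal s = 0 := by
  rw [Current.liftVal]
  refine Finset.sum_eq_zero fun e he => ?_
  exact absurd (Finset.mem_filter.1 he).2 (hs e)

/-- Lifting values is additive. [folklore] -/
theorem Current.liftVal_add (n m : Current G) : (n + m).liftVal = n.liftVal + m.liftVal := by
  funext s
  simp only [Current.liftVal, Pi.add_apply, Finset.sum_add_distrib]

/-- The lifted value of the zero current vanishes. [folklore] -/
@[simp] theorem Current.liftVal_zero : (0 : Current G).liftVal = (0 : Sym2 (Site d) → ℕ) := by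
  funext s
  simp [Current.liftVal]

/-- **The support of the lifted values is the lifted trace** (`liftBonds d L n.traced`). [folklore] -/
theorem Current.one_le_liftVal_iff (n : Current G) (s : Sym2 (Site d)) :
    1 ≤ n.liftVal s ↔ s ∈ liftBonds d L n.traced := by
  constructor
  · intro h
    have hne : (univ.filter fun e : G.edgeFinset => Sym2.map Subtype.val (e : Sym2 (BoxVertex d L)) = s).Nonempty := by
      by_contra hempty
      rw [Finset.not_nonempty_iff_eq_empty] at hempty
      rw [Current.liftVal, hempty, Finset.sum_empty] at h
      exact absurd h (by norm_num)
    obtain ⟨e, he⟩ := hne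
    have hes : Sym2.map Subtype.val (e : Sym2 (BoxVertex d L)) = s := (Finset.mem_filter.1 he).2
    rw [← hes, Current.liftVal_map] at h
    refine ⟨e, ?_, hes⟩
    rw [Current.mem_traced_iff]
    exact h
  · rintro ⟨e', he', rfl⟩
    obtain ⟨hG, hpos⟩ := he'
    have h := Current.liftVal_map n ⟨e', hG⟩
    simp only at h
    rw [h]
    exact hpos

/-- The lifted trace of the encoded lifted values. [folklore] -/
theorem capTrace_capEnc_liftVal (n : Current G) : capTrace (capEnc n.liftVal) = liftBonds d L n.traced := by
  rw [capTrace_capEnc]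
  ext s
  exact n.one_le_liftVal_iff s

/-- A bond carrying a positive lifted value is a bond of the box graph, read in `ℤ^d`. [folklore] -/
theorem Current.exists_map_eq_of_liftVal_ne_zero (n : Current G) {s : Sym2 (Site d)} (h : n.liftVal s ≠ 0) :
    ∃ e : G.edgeFinset, Sym2.map Subtype.val (e : Sym2 (BoxVertex d L)) = s := by
  by_contra hne
  push Not at hne
  exact h (n.liftVal_eq_zero hne)

end LiftVal

/-- Edges of the plus box graph lie over lattice bonds. [folklore] -/
theorem map_val_mem_edgeSet_plusBoxGraph {L : ℕ} (e : (plusBoxGraph d L).edgeFinset) :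
    Sym2.map Subtype.val (e : Sym2 (BoxVertex d L)) ∈ (zdGraph d).edgeSet := by
  obtain ⟨e, he⟩ := e
  induction e using Sym2.ind with
  | _ a b =>
    rw [Sym2.map_mk, SimpleGraph.mem_edgeSet]
    exact ((SimpleGraph.mem_edgeSet _).1 (SimpleGraph.mem_edgeFinset.1 he)).1

/-- Edges of the free box graph lie over lattice bonds. [folklore] -/
theorem map_val_mem_edgeSet_freeBoxGraph {L : ℕ} (e : (freeBoxGraph d L).edgeFinset) :
    Sym2.map Subtype.val (e : Sym2 (BoxVertex d L)) ∈ (zdGraph d).edgeSet := by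
  obtain ⟨e, he⟩ := e
  induction e using Sym2.ind with
  | _ a b =>
    rw [Sym2.map_mk, SimpleGraph.mem_edgeSet]
    exact ((SimpleGraph.mem_edgeSet _).1 (SimpleGraph.mem_edgeFinset.1 he)).1

/-- The lifted values of a plus box current vanish off the lattice bonds. [folklore] -/
theorem liftVal_eq_zero_of_not_mem_edgeSet_plus {L : ℕ} (n : Current (plusBoxGraph d L)) {s : Sym2 (Site d)}
    (hs : s ∉ (zdGraph d).edgeSet) : n.liftVal s = 0 :=
  n.liftVal_eq_zero fun e he => hs (he ▸ map_val_mem_edgeSet_plusBoxGraph e)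

/-- The lifted values of a free box current vanish off the lattice bonds. [folklore] -/
theorem liftVal_eq_zero_of_not_mem_edgeSet_free {L : ℕ} (n : Current (freeBoxGraph d L)) {s : Sym2 (Site d)}
    (hs : s ∉ (zdGraph d).edgeSet) : n.liftVal s = 0 :=
  n.liftVal_eq_zero fun e he => hs (he ▸ map_val_mem_edgeSet_freeBoxGraph e)

/-! ### Countable sums of Dirac masses -/

section DiracSum

variable {α X : Type*} [Countable α] [MeasurableSpace X] [MeasurableSingletonClass X]

open Classical in
/-- A countable sum of weighted Dirac masses, evaluated on a set: `(∑_a w_a δ_{x_a})(s) = ∑_a w_a 𝟙[x_a ∈ s]`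
(real form, nonnegative weights). [folklore] -/
theorem real_sum_smul_dirac_apply (w : α → ℝ) (hw : ∀ a, 0 ≤ w a) (x : α → X) (s : Set X) :
    (Measure.sum fun a => ENNReal.ofReal (w a) • Measure.dirac (x a)).real s =
      ∑' a, w a * (if x a ∈ s then 1 else 0) := by
  classical
  rw [measureReal_def, Measure.sum_apply_of_countable]
  simp only [Measure.smul_apply, smul_eq_mul, Measure.dirac_apply]
  rw [ENNReal.tsum_toReal_eq]
  · refine tsum_congr fun a => ?_
    by_cases ha : x a ∈ s
    · rw [Set.indicator_of_mem ha, if_pos ha, Pi.one_apply, mul_one, mul_one, ENNReal.toReal_ofReal (hw a)]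
    · rw [Set.indicator_of_notMem ha, if_neg ha, mul_zero, mul_zero, ENNReal.toReal_zero]
  · intro a
    exact ENNReal.mul_ne_top ENNReal.ofReal_ne_top
      (ne_top_of_le_ne_top ENNReal.one_ne_top (Set.indicator_le_self' (fun _ _ => zero_le_one) _))

omit [MeasurableSingletonClass X] in
/-- A countable sum of weighted Dirac masses with weights summing to `1` is a probability measure. [folklore] -/
theorem isProbabilityMeasure_sum_smul_dirac (w : α → ℝ) (hw : ∀ a, 0 ≤ w a) (hw1 : HasSum w 1) (x : α → X) :
    IsProbabilityMeasure (Measure.sum fun a => ENNReal.ofReal (w a) • Measure.dirac (x a)) := by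
  constructor
  rw [Measure.sum_apply_of_countable]
  simp only [Measure.smul_apply, Measure.dirac_apply_of_mem (Set.mem_univ _), smul_eq_mul, mul_one]
  rw [← ENNReal.ofReal_one, ← hw1.tsum_eq, ENNReal.ofReal_tsum_of_nonneg hw hw1.summable]

omit [Countable α] in
/-- The push-forward of a countable sum of weighted Dirac masses along a measurable map. [folklore] -/
theorem map_sum_smul_dirac {Y : Type*} [MeasurableSpace Y] [MeasurableSingletonClass Y] (w : α → ℝ≥0∞)
    (x : α → X) {f : X → Y} (hf : Measurable f) :
    (Measure.sum fun a => w a • Measure.dirac (x a)).map f = Measure.sum fun a => w a • Measure.dirac (f (x a)) := by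
  rw [Measure.map_sum hf.aemeasurable]
  congr 1
  funext a
  rw [Measure.map_smul, Measure.map_dirac]

end DiracSum

/-! ### The capped laws of the box currents -/

variable (d)

/-- The weight `𝟙[∂n ∩ Λ_L = ∅] w_β(n)` of a current of a box graph (the summand of the tree's
`plusCurrentSum G (boxCore d L) β ∅`). [cite: AizenmanDuminilCopinSidoraviciusCMP2015, §2.1, eq. (2.8)] -/
def sourcelessWeight {L : ℕ} {G : SimpleGraph (BoxVertex d L)} [DecidableRel G.Adj] (β : ℝ) (n : Current G) : ℝ :=
  if n.sources ∩ boxCore d L = ∅ then n.weight β else 0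

/-- **The capped law of the sourceless `+` current of `Λ_L`** (`P_{Λ_L ∪ δ, β}` of Raoufi 2020,
Thm. 2, in the ghost-free form of the tree, read through `capEnc ∘ liftVal`): the probability measure
`∑_n 𝟙[∂n ∩ Λ_L = ∅] w_β(n)/Z⁺ · δ_{capEnc (liftVal n)}` on capped configurations. [cite: Raoufi2020, §2, Thm. 2] -/
def plusCapLaw (L : ℕ) (β : ℝ) : Measure (CapConfig d) :=
  Measure.sum fun n : Current (plusBoxGraph d L) =>
    ENNReal.ofReal (sourcelessWeight d β n / plusCurrentSum (plusBoxGraph d L) (boxCore d L) β ∅) •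
      Measure.dirac (capEnc n.liftVal)

/-- **The capped law of the sourceless free current of `Λ_L`** (`P_{Λ_L, β}` of Raoufi 2020, Thm. 2). [cite: Raoufi2020, §2, Thm. 2] -/
def freeCapLaw (L : ℕ) (β : ℝ) : Measure (CapConfig d) :=
  Measure.sum fun n : Current (freeBoxGraph d L) =>
    ENNReal.ofReal (sourcelessWeight d β n / plusCurrentSum (freeBoxGraph d L) (boxCore d L) β ∅) •
      Measure.dirac (capEnc n.liftVal)

/-- **The capped law of the sum `n₁ + n₂`** of a sourceless free current `n₁` of `Λ_L` and an
independent sourceless `+` current `n₂` of `Λ_L` (the finite-volume form of Raoufi's `P⁰ ⊗ P⁺`,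
"the law of the sum of two independent currents"; the pair weights are the tree's
`adsPairWeight d L β`, ADS15 (3.1)). [cite: Raoufi2020, §2, after Thm. 2] -/
def sumCapLaw (L : ℕ) (β : ℝ) : Measure (CapConfig d) :=
  Measure.sum fun p : Current (freeBoxGraph d L) × Current (plusBoxGraph d L) =>
    ENNReal.ofReal (adsPairWeight d L β p / adsPairNorm d L β) •
      Measure.dirac (capEnc (p.1.liftVal + p.2.liftVal))

variable {d}

/-- The sourceless weights are nonnegative for `β ≥ 0`. [folklore] -/
theorem sourcelessWeight_nonneg {L : ℕ} {G : SimpleGraph (BoxVertex d L)} [DecidableRel G.Adj] {β : ℝ}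
    (hβ : 0 ≤ β) (n : Current G) : 0 ≤ sourcelessWeight d β n := by
  unfold sourcelessWeight
  split_ifs
  · exact Current.weight_nonneg hβ n
  · exact le_rfl

/-- The sourceless weights sum to `plusCurrentSum G (boxCore d L) β ∅`. [folklore] -/
theorem hasSum_sourcelessWeight {L : ℕ} {G : SimpleGraph (BoxVertex d L)} [DecidableRel G.Adj] (β : ℝ) :
    HasSum (sourcelessWeight d β (G := G)) (plusCurrentSum G (boxCore d L) β ∅) :=
  (summable_plusCurrentSum_term G (boxCore d L) β ∅).hasSum

/-- Summability of the normalised sourceless weights against a bounded test function. [folklore] -/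
theorem summable_sourcelessWeight_div_mul {L : ℕ} {G : SimpleGraph (BoxVertex d L)} [DecidableRel G.Adj] (β Z : ℝ)
    (g : Current G → ℝ) (hg : ∀ n, |g n| ≤ 1) :
    Summable fun n : Current G => sourcelessWeight d β n / Z * g n := by
  refine ((hasSum_sourcelessWeight (G := G) β).summable.div_const Z).norm.of_norm_bounded fun n => ?_
  rw [norm_mul]
  exact mul_le_of_le_one_right (norm_nonneg _) (by rw [Real.norm_eq_abs]; exact hg n)

/-- Summability of the normalised pair weights against a bounded test function (`β ≥ 0`). [folklore] -/
theorem summable_adsPairWeight_div_mul (L : ℕ) {β : ℝ} (hβ : 0 ≤ β)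
    (g : Current (freeBoxGraph d L) × Current (plusBoxGraph d L) → ℝ) (hg : ∀ p, |g p| ≤ 1) :
    Summable fun p => adsPairWeight d L β p / adsPairNorm d L β * g p := by
  have h := (summable_adsPairWeight_mul d L hβ g hg).div_const (adsPairNorm d L β)
  refine h.congr fun p => ?_
  ring

/-- Indicators are bounded by one in absolute value. [folklore] -/
theorem abs_ite_le_one (P : Prop) [Decidable P] : |(if P then (1 : ℝ) else 0)| ≤ 1 := by
  split_ifs <;> simp

/-- The normaliser of the `+` current is positive. [folklore] -/
theorem plusCurrentSum_plusBoxGraph_pos (L : ℕ) (β : ℝ) :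
    0 < plusCurrentSum (plusBoxGraph d L) (boxCore d L) β ∅ :=
  plusCurrentSum_empty_pos _ (edgesTouching_plusBoxGraph d L) β

/-- The normaliser of the free current is positive. [folklore] -/
theorem plusCurrentSum_freeBoxGraph_pos (L : ℕ) (β : ℝ) :
    0 < plusCurrentSum (freeBoxGraph d L) (boxCore d L) β ∅ :=
  plusCurrentSum_empty_pos _ (edgesTouching_freeBoxGraph d L) β

variable (d)

/-- **The `+` capped law is a probability measure** (`β ≥ 0`). [cite: Raoufi2020, §2, Thm. 2] -/
theorem isProbabilityMeasure_plusCapLaw (L : ℕ) {β : ℝ} (hβ : 0 ≤ β) : IsProbabilityMeasure (plusCapLaw d L β) := by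
  have hZ := plusCurrentSum_plusBoxGraph_pos (d := d) L β
  refine isProbabilityMeasure_sum_smul_dirac _ (fun n => div_nonneg (sourcelessWeight_nonneg hβ n) hZ.le) ?_ _
  have h := (hasSum_sourcelessWeight (G := plusBoxGraph d L) β).div_const (plusCurrentSum (plusBoxGraph d L) (boxCore d L) β ∅)
  rwa [div_self hZ.ne'] at h

/-- **The free capped law is a probability measure** (`β ≥ 0`). [cite: Raoufi2020, §2, Thm. 2] -/
theorem isProbabilityMeasure_freeCapLaw (L : ℕ) {β : ℝ} (hβ : 0 ≤ β) : IsProbabilityMeasure (freeCapLaw d L β) := by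
  have hZ := plusCurrentSum_freeBoxGraph_pos (d := d) L β
  refine isProbabilityMeasure_sum_smul_dirac _ (fun n => div_nonneg (sourcelessWeight_nonneg hβ n) hZ.le) ?_ _
  have h := (hasSum_sourcelessWeight (G := freeBoxGraph d L) β).div_const (plusCurrentSum (freeBoxGraph d L) (boxCore d L) β ∅)
  rwa [div_self hZ.ne'] at h

/-- **The summed capped law is a probability measure** (`β ≥ 0`). [cite: Raoufi2020, §2, after Thm. 2] -/
theorem isProbabilityMeasure_sumCapLaw (L : ℕ) {β : ℝ} (hβ : 0 ≤ β) : IsProbabilityMeasure (sumCapLaw d L β) := by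
  have hN := adsPairNorm_pos d L hβ
  refine isProbabilityMeasure_sum_smul_dirac _ (fun p => div_nonneg (adsPairWeight_nonneg d L hβ p) hN.le) ?_ _
  have h := (hasSum_adsPairWeight d L hβ).div_const (adsPairNorm d L β)
  rwa [div_self hN.ne'] at h

open Classical in
/-- **The `+` capped law evaluated on an event**: `∑_n 𝟙[∂n∩Λ=∅] w(n)/Z⁺ · 𝟙[capEnc (liftVal n) ∈ s]`. [cite: Raoufi2020, §2, Thm. 2] -/
theorem plusCapLaw_real_apply (L : ℕ) {β : ℝ} (hβ : 0 ≤ β) (s : Set (CapConfig d)) :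
    (plusCapLaw d L β).real s = ∑' n : Current (plusBoxGraph d L),
      sourcelessWeight d β n / plusCurrentSum (plusBoxGraph d L) (boxCore d L) β ∅ *
        (if capEnc n.liftVal ∈ s then 1 else 0) :=
  real_sum_smul_dirac_apply _ (fun n => div_nonneg (sourcelessWeight_nonneg hβ n)
    (plusCurrentSum_plusBoxGraph_pos L β).le) _ s

open Classical in
/-- **The free capped law evaluated on an event**. [cite: Raoufi2020, §2, Thm. 2] -/
theorem freeCapLaw_real_apply (L : ℕ) {β : ℝ} (hβ : 0 ≤ β) (s : Set (CapConfig d)) :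
    (freeCapLaw d L β).real s = ∑' n : Current (freeBoxGraph d L),
      sourcelessWeight d β n / plusCurrentSum (freeBoxGraph d L) (boxCore d L) β ∅ *
        (if capEnc n.liftVal ∈ s then 1 else 0) :=
  real_sum_smul_dirac_apply _ (fun n => div_nonneg (sourcelessWeight_nonneg hβ n)
    (plusCurrentSum_freeBoxGraph_pos L β).le) _ s

open Classical in
/-- **The summed capped law evaluated on an event**. [cite: Raoufi2020, §2, after Thm. 2] -/
theorem sumCapLaw_real_apply (L : ℕ) {β : ℝ} (hβ : 0 ≤ β) (s : Set (CapConfig d)) :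
    (sumCapLaw d L β).real s = ∑' p : Current (freeBoxGraph d L) × Current (plusBoxGraph d L),
      adsPairWeight d L β p / adsPairNorm d L β *
        (if capEnc (p.1.liftVal + p.2.liftVal) ∈ s then 1 else 0) :=
  real_sum_smul_dirac_apply _ (fun p => div_nonneg (adsPairWeight_nonneg d L hβ p) (adsPairNorm_pos d L hβ).le) _ s

/-! ### The trace of the summed law is the double current of the tree -/

/-- The support of `k₁ + k₂` is the union of the supports. [folklore] -/
theorem capTrace_capEnc_add (k₁ k₂ : Sym2 (Site d) → ℕ) :
    capTrace (capEnc (k₁ + k₂)) = capTrace (capEnc k₁) ∪ capTrace (capEnc k₂) := by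
  ext e
  simp only [capTrace_capEnc, Set.mem_setOf_eq, Pi.add_apply, Set.mem_union]
  omega

/-- **The trace of the summed capped law is `ℙ_{Λ_L,β}`**: pushing `sumCapLaw d L β` forward along
`capTrace` gives the tree's box double current `adsDoubleCurrentLaw d L β` (the law of the trace
`n̂₁ ∪ n̂₂`, ADS15 §2.3 / (3.1); Raoufi's `P_{B_n} ⊗ P_{B_n ∪ δ}` read on the trace). [cite: AizenmanDuminilCopinSidoraviciusCMP2015, §2.3 and §3.1, eq. (3.1)] -/
theorem sumCapLaw_map_capTrace (L : ℕ) (β : ℝ) :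
    (sumCapLaw d L β).map capTrace = adsDoubleCurrentLaw d L β := by
  rw [sumCapLaw, map_sum_smul_dirac _ _ measurable_capTrace, adsDoubleCurrentLaw]
  congr 1
  funext p
  rw [capTrace_capEnc_add, capTrace_capEnc_liftVal, capTrace_capEnc_liftVal, liftBonds_union]

open Classical in
/-- The trace of the `+` capped law evaluated on an event: the law of the lifted trace of the
sourceless `+` current. [folklore] -/
theorem plusCapLaw_map_capTrace_real_apply (L : ℕ) {β : ℝ} (hβ : 0 ≤ β) (s : Set (BondConfig (Site d))) :
    ((plusCapLaw d L β).map capTrace).real s = ∑' n : Current (plusBoxGraph d L),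
      sourcelessWeight d β n / plusCurrentSum (plusBoxGraph d L) (boxCore d L) β ∅ *
        (if liftBonds d L n.traced ∈ s then 1 else 0) := by
  rw [plusCapLaw, map_sum_smul_dirac _ _ measurable_capTrace]
  simp_rw [capTrace_capEnc_liftVal]
  exact real_sum_smul_dirac_apply _ (fun n => div_nonneg (sourcelessWeight_nonneg hβ n)
    (plusCurrentSum_plusBoxGraph_pos L β).le) _ s

/-! ### Capped cylinders -/

variable {d}

/-- **The capped cylinder on `S` with pattern `(A₁, A₂)`**: on each bond `s ∈ S`, `n_s ≥ 1` iff
`s ∈ A₁` and `n_s ≥ 2` iff `s ∈ A₂` (for a pattern one has `A₂ ⊆ A₁ ⊆ S`; in general the event is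
empty on encoded configurations unless `A₂ ∩ S ⊆ A₁`). [cite: Raoufi2020, §2, Thm. 2] -/
def capCyl (S A₁ A₂ : Finset (Sym2 (Site d))) : Set (CapConfig d) :=
  {ω | ∀ s ∈ S, ((s, false) ∈ ω ↔ s ∈ A₁) ∧ ((s, true) ∈ ω ↔ s ∈ A₂)}

/-- Membership in a capped cylinder. [folklore] -/
theorem mem_capCyl_iff (S A₁ A₂ : Finset (Sym2 (Site d))) (ω : CapConfig d) :
    ω ∈ capCyl S A₁ A₂ ↔ ∀ s ∈ S, ((s, false) ∈ ω ↔ s ∈ A₁) ∧ ((s, true) ∈ ω ↔ s ∈ A₂) :=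
  Iff.rfl

/-- An encoded function lies in a capped cylinder iff its capped values follow the pattern. [folklore] -/
theorem capEnc_mem_capCyl_iff (k : Sym2 (Site d) → ℕ) (S A₁ A₂ : Finset (Sym2 (Site d))) :
    capEnc k ∈ capCyl S A₁ A₂ ↔ ∀ s ∈ S, (1 ≤ k s ↔ s ∈ A₁) ∧ (2 ≤ k s ↔ s ∈ A₂) := by
  simp only [mem_capCyl_iff, mk_false_mem_capEnc_iff, mk_true_mem_capEnc_iff]

/-- **Capped cylinders are cylinders** of the configuration space `Set (Sym2 (Site d) × Bool)`:
`capCyl S A₁ A₂ = [A₁ × {ff} ∪ A₂ × {tt}]_{S × {ff,tt}}` (`localCylinder`, `PercolationEvents.lean`). [folklore] -/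
theorem capCyl_eq_localCylinder (S A₁ A₂ : Finset (Sym2 (Site d))) :
    capCyl S A₁ A₂ = localCylinder (↑(S ×ˢ (univ : Finset Bool)) : Set (Sym2 (Site d) × Bool))
      (↑(A₁ ×ˢ ({false} : Finset Bool) ∪ A₂ ×ˢ ({true} : Finset Bool)) : Set (Sym2 (Site d) × Bool)) := by
  ext ω
  simp only [mem_capCyl_iff, localCylinder, Set.mem_setOf_eq, Finset.coe_product, Finset.coe_univ,
    Set.mem_prod, Set.mem_univ, and_true, Finset.coe_union, Set.mem_union, Finset.coe_singleton,
    Set.mem_singleton_iff, Prod.forall]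
  constructor
  · intro h s b hs
    cases b
    · simpa using (h s hs).1
    · simpa using (h s hs).2
  · intro h s hs
    exact ⟨by simpa using h s false hs, by simpa using h s true hs⟩

/-- Capped cylinders are determined by the coordinates over `S`. [folklore] -/
theorem determinedBy_capCyl (S A₁ A₂ : Finset (Sym2 (Site d))) :
    DeterminedBy (capCyl S A₁ A₂) (↑(S ×ˢ (univ : Finset Bool)) : Set (Sym2 (Site d) × Bool)) := by
  rw [determinedBy_iff]
  intro ω ω' h
  have key : ∀ s ∈ S, ∀ b : Bool, ((s, b) ∈ ω ↔ (s, b) ∈ ω') := by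
    intro s hs b
    have hsb : (s, b) ∈ (↑(S ×ˢ (univ : Finset Bool)) : Set (Sym2 (Site d) × Bool)) := by
      simp [hs]
    exact ⟨fun h1 => ((Set.ext_iff.1 h (s, b)).1 ⟨h1, hsb⟩).1, fun h1 => ((Set.ext_iff.1 h (s, b)).2 ⟨h1, hsb⟩).1⟩
  simp only [mem_capCyl_iff]
  refine forall₂_congr fun s hs => ?_
  rw [key s hs false, key s hs true]

/-- Capped cylinders are local events. [folklore] -/
theorem isLocalEvent_capCyl (S A₁ A₂ : Finset (Sym2 (Site d))) : IsLocalEvent (capCyl S A₁ A₂) :=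
  ⟨_, determinedBy_capCyl S A₁ A₂⟩

/-- Capped cylinders are measurable. [folklore] -/
theorem measurableSet_capCyl (S A₁ A₂ : Finset (Sym2 (Site d))) : MeasurableSet (capCyl S A₁ A₂) :=
  measurableSet_of_isLocalEvent_holds (isLocalEvent_capCyl S A₁ A₂)

/-- **Value cylinders** `{n = 𝟙_{S₁} on S}` are the capped cylinders `capCyl S S₁ ∅`: an encoded
function lies in `capCyl S S₁ ∅` iff it equals `𝟙_{S₁}` on `S`. [folklore] -/
theorem capEnc_mem_capCyl_empty_iff (k : Sym2 (Site d) → ℕ) (S S₁ : Finset (Sym2 (Site d))) :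
    capEnc k ∈ capCyl S S₁ ∅ ↔ ∀ s ∈ S, k s = if s ∈ S₁ then 1 else 0 := by
  rw [capEnc_mem_capCyl_iff]
  refine forall₂_congr fun s _ => ?_
  simp only [Finset.notMem_empty, iff_false, not_le]
  by_cases h1 : s ∈ S₁
  · simp only [h1, iff_true, if_true]; omega
  · simp only [h1, iff_false, not_le, if_false]; omega

/-- Division by a constant commutes with `tsum` (weights times indicators). [folklore] -/
theorem tsum_div_mul_ite {ι : Type*} (f : ι → ℝ) (Z : ℝ) (P : ι → Prop) [DecidablePred P] :
    ∑' i, f i / Z * (if P i then 1 else 0) = (∑' i, if P i then f i else 0) / Z := by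
  rw [← tsum_div_const]
  refine tsum_congr fun i => ?_
  split_ifs <;> ring

/-- **The `+` capped law of a value cylinder is `plusCurrentValProb`**: for `β ≥ 0` and `S` a set of
lattice bonds inside `Λ_L`, `plusCapLaw d L β (capCyl S S₁ ∅) = P̂⁺_{Λ_L,β}[n = 𝟙_{S₁} on S]`
(`CurrentValueLaw.lean`). [cite: Raoufi2020, §2, Thm. 2] -/
theorem plusCapLaw_real_valCyl (L : ℕ) {β : ℝ} (hβ : 0 ≤ β) {S : Finset (Sym2 (Site d))}
    (hS : S ⊆ edgesIn (zdGraph d) (box d L)) (S₁ : Finset (Sym2 (Site d))) :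
    (plusCapLaw d L β).real (capCyl S S₁ ∅) = plusCurrentValProb d L β S S₁ := by
  classical
  rw [plusCapLaw_real_apply d L hβ, tsum_div_mul_ite, plusCurrentValProb, plusCurrentSumVal]
  congr 1
  refine tsum_congr fun n => ?_
  have hiff : capEnc n.liftVal ∈ capCyl S S₁ ∅ ↔
      ∀ e : (plusBoxGraph d L).edgeFinset, (e : Sym2 (BoxVertex d L)) ∈ boxBonds d L S →
        n e = if (e : Sym2 (BoxVertex d L)) ∈ boxBonds d L S₁ then 1 else 0 := by
    rw [capEnc_mem_capCyl_empty_iff]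
    constructor
    · intro h e he
      rw [boxBonds, Finset.mem_filter] at he
      have h1 := h _ he.2
      rw [Current.liftVal_map] at h1
      rw [h1, boxBonds]
      simp only [Finset.mem_filter, e.2, true_and]
    · intro h s hs
      obtain ⟨e, he, hes⟩ := exists_plusBoxGraph_edge_of_mem_edgesIn (hS hs)
      have h1 := h ⟨e, he⟩ (by rw [boxBonds, Finset.mem_filter]; exact ⟨he, by rw [hes]; exact hs⟩)
      rw [← hes]
      have h2 := Current.liftVal_map n ⟨e, he⟩
      simp only at h2
      rw [h2, h1, boxBonds]
      simp only [Finset.mem_filter, he, true_and, hes]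
  unfold sourcelessWeight
  by_cases hsrc : n.sources ∩ boxCore d L = ∅
  · by_cases hc : capEnc n.liftVal ∈ capCyl S S₁ ∅
    · rw [if_pos hc, if_pos hsrc, if_pos ⟨hsrc, hiff.1 hc⟩]
    · rw [if_neg hc, if_neg (fun h => hc (hiff.2 h.2))]
  · rw [if_neg hsrc, ite_self, if_neg (fun h => hsrc h.1)]

/-- **The free capped law of a value cylinder is `freeCurrentValProb`** (`β ≥ 0`, `S ⊆ ℰ_{Λ_L}`). [cite: Raoufi2020, §2, Thm. 2] -/
theorem freeCapLaw_real_valCyl (L : ℕ) {β : ℝ} (hβ : 0 ≤ β) {S : Finset (Sym2 (Site d))}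
    (hS : S ⊆ edgesIn (zdGraph d) (box d L)) (S₁ : Finset (Sym2 (Site d))) :
    (freeCapLaw d L β).real (capCyl S S₁ ∅) = freeCurrentValProb d L β S S₁ := by
  classical
  rw [freeCapLaw_real_apply d L hβ, tsum_div_mul_ite, freeCurrentValProb, plusCurrentSumVal]
  congr 1
  refine tsum_congr fun n => ?_
  have hiff : capEnc n.liftVal ∈ capCyl S S₁ ∅ ↔
      ∀ e : (freeBoxGraph d L).edgeFinset, (e : Sym2 (BoxVertex d L)) ∈ freeBoxBonds d L S →
        n e = if (e : Sym2 (BoxVertex d L)) ∈ freeBoxBonds d L S₁ then 1 else 0 := by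
    rw [capEnc_mem_capCyl_empty_iff]
    constructor
    · intro h e he
      rw [freeBoxBonds, Finset.mem_filter] at he
      have h1 := h _ he.2
      rw [Current.liftVal_map] at h1
      rw [h1, freeBoxBonds]
      simp only [Finset.mem_filter, e.2, true_and]
    · intro h s hs
      obtain ⟨e, he, hes⟩ := exists_freeBoxGraph_edge_of_mem_edgesIn (hS hs)
      have h1 := h ⟨e, he⟩ (by rw [freeBoxBonds, Finset.mem_filter]; exact ⟨he, by rw [hes]; exact hs⟩)
      rw [← hes]
      have h2 := Current.liftVal_map n ⟨e, he⟩
      simp only at h2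
      rw [h2, h1, freeBoxBonds]
      simp only [Finset.mem_filter, he, true_and, hes]
  unfold sourcelessWeight
  by_cases hsrc : n.sources ∩ boxCore d L = ∅
  · by_cases hc : capEnc n.liftVal ∈ capCyl S S₁ ∅
    · rw [if_pos hc, if_pos hsrc, if_pos ⟨hsrc, hiff.1 hc⟩]
    · rw [if_neg hc, if_neg (fun h => hc (hiff.2 h.2))]
  · rw [if_neg hsrc, ite_self, if_neg (fun h => hsrc h.1)]

/-! ### Inclusion–exclusion: capped cylinders as signed sums of value cylinders -/

section InclusionExclusion

variable {α : Type*} [DecidableEq α]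

/-- The capped pattern condition splits into the three value classes. [folklore] -/
theorem cap_pattern_iff (k : α → ℕ) {S A₁ A₂ : Finset α} (h₁ : A₁ ⊆ S) (h₂ : A₂ ⊆ A₁) :
    (∀ s ∈ S, (1 ≤ k s ↔ s ∈ A₁) ∧ (2 ≤ k s ↔ s ∈ A₂)) ↔
      ((∀ s ∈ S \ A₁, k s = 0) ∧ (∀ s ∈ A₁ \ A₂, k s = 1)) ∧ (∀ s ∈ A₂, 2 ≤ k s) := by
  constructor
  · intro h
    refine ⟨⟨fun s hs => ?_, fun s hs => ?_⟩, fun s hs => ?_⟩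
    · rw [Finset.mem_sdiff] at hs
      have h1 := (h s hs.1).1
      have : ¬(1 ≤ k s) := fun hk => hs.2 (h1.1 hk)
      omega
    · rw [Finset.mem_sdiff] at hs
      have h1 := h s (h₁ hs.1)
      have ha : 1 ≤ k s := h1.1.2 hs.1
      have hb : ¬(2 ≤ k s) := fun hk => hs.2 (h1.2.1 hk)
      omega
    · exact (h s (h₁ (h₂ hs))).2.2 hs
  · rintro ⟨⟨h0, h1⟩, h2'⟩ s hs
    by_cases hsA₂ : s ∈ A₂
    · have h2 := h2' s hsA₂
      exact ⟨⟨fun _ => h₂ hsA₂, fun _ => by omega⟩, ⟨fun _ => hsA₂, fun _ => h2⟩⟩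
    · by_cases hsA₁ : s ∈ A₁
      · have hk := h1 s (Finset.mem_sdiff.2 ⟨hsA₁, hsA₂⟩)
        exact ⟨⟨fun _ => hsA₁, fun _ => by omega⟩, ⟨fun hk2 => by omega, fun h => absurd h hsA₂⟩⟩
      · have hk := h0 s (Finset.mem_sdiff.2 ⟨hs, hsA₁⟩)
        exact ⟨⟨fun hk1 => by omega, fun h => absurd h hsA₁⟩, ⟨fun hk2 => by omega, fun h => absurd h hsA₂⟩⟩

/-- The value condition `k = 𝟙_{(A₁∖A₂) ∪ T₁}` on `(S ∖ A₂) ∪ T`, split into its four classes. [folklore] -/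
theorem val_pattern_iff (k : α → ℕ) {S A₁ A₂ T T₁ : Finset α} (h₁ : A₁ ⊆ S) (h₂ : A₂ ⊆ A₁)
    (hT : T ⊆ A₂) (hT₁ : T₁ ⊆ T) :
    (((∀ s ∈ S \ A₁, k s = 0) ∧ (∀ s ∈ A₁ \ A₂, k s = 1)) ∧ ((∀ s ∈ T₁, k s = 1) ∧ (∀ s ∈ T \ T₁, k s = 0))) ↔
      ∀ s ∈ (S \ A₂) ∪ T, k s = if s ∈ (A₁ \ A₂) ∪ T₁ then 1 else 0 := by
  constructor
  · rintro ⟨⟨h0, h1⟩, ⟨g1, g0⟩⟩ s hs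
    rcases Finset.mem_union.1 hs with hs | hs
    · rw [Finset.mem_sdiff] at hs
      by_cases hsA₁ : s ∈ A₁
      · rw [if_pos (Finset.mem_union_left _ (Finset.mem_sdiff.2 ⟨hsA₁, hs.2⟩))]
        exact h1 s (Finset.mem_sdiff.2 ⟨hsA₁, hs.2⟩)
      · rw [if_neg]
        · exact h0 s (Finset.mem_sdiff.2 ⟨hs.1, hsA₁⟩)
        · intro h
          rcases Finset.mem_union.1 h with h | h
          · exact hsA₁ (Finset.mem_sdiff.1 h).1
          · exact hsA₁ (h₂ (hT (hT₁ h)))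
    · by_cases hsT₁ : s ∈ T₁
      · rw [if_pos (Finset.mem_union_right _ hsT₁)]
        exact g1 s hsT₁
      · rw [if_neg]
        · exact g0 s (Finset.mem_sdiff.2 ⟨hs, hsT₁⟩)
        · intro h
          rcases Finset.mem_union.1 h with h | h
          · exact (Finset.mem_sdiff.1 h).2 (hT hs)
          · exact hsT₁ h
  · intro h
    refine ⟨⟨fun s hs => ?_, fun s hs => ?_⟩, ⟨fun s hs => ?_, fun s hs => ?_⟩⟩
    · rw [Finset.mem_sdiff] at hs
      have hk := h s (Finset.mem_union_left _ (Finset.mem_sdiff.2 ⟨hs.1, fun h' => hs.2 (h₂ h')⟩))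
      rw [if_neg] at hk
      · exact hk
      · intro h'
        rcases Finset.mem_union.1 h' with h' | h'
        · exact hs.2 (Finset.mem_sdiff.1 h').1
        · exact hs.2 (h₂ (hT (hT₁ h')))
    · have hs' := Finset.mem_sdiff.1 hs
      have hk := h s (Finset.mem_union_left _ (Finset.mem_sdiff.2 ⟨h₁ hs'.1, hs'.2⟩))
      rwa [if_pos (Finset.mem_union_left _ hs)] at hk
    · have hk := h s (Finset.mem_union_right _ (hT₁ hs))
      rwa [if_pos (Finset.mem_union_right _ hs)] at hk
    · rw [Finset.mem_sdiff] at hs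
      have hk := h s (Finset.mem_union_right _ hs.1)
      rw [if_neg] at hk
      · exact hk
      · intro h'
        rcases Finset.mem_union.1 h' with h' | h'
        · exact (Finset.mem_sdiff.1 h').2 (hT hs.1)
        · exact hs.2 h'

/-- `𝟙[n ≥ 2] = 1 - 𝟙[n = 1] - 𝟙[n = 0]`. [folklore] -/
theorem ite_two_le_eq (n : ℕ) :
    (if 2 ≤ n then (1 : ℝ) else 0) = 1 - ((if n = 1 then (1 : ℝ) else 0) + (if n = 0 then (1 : ℝ) else 0)) := by
  rcases Nat.lt_or_ge n 2 with h | h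
  · interval_cases n <;> simp
  · rw [if_pos h, if_neg (by omega), if_neg (by omega)]; ring

/-- **Inclusion–exclusion for capped patterns**: for `A₂ ⊆ A₁ ⊆ S` and `k : α → ℕ`, the indicator
of "`k ≥ 1` exactly on `A₁` and `k ≥ 2` exactly on `A₂` (within `S`)" equals
`∑_{T ⊆ A₂} ∑_{T₁ ⊆ T} (-1)^{|T|} 𝟙[k = 𝟙_{(A₁∖A₂) ∪ T₁} on (S ∖ A₂) ∪ T]`, by expanding
`∏_{s ∈ A₂} (1 - 𝟙[k_s = 1] - 𝟙[k_s = 0])`. [folklore] -/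
theorem indicator_cap_eq_sum (k : α → ℕ) {S A₁ A₂ : Finset α} (h₁ : A₁ ⊆ S) (h₂ : A₂ ⊆ A₁) :
    (if ∀ s ∈ S, (1 ≤ k s ↔ s ∈ A₁) ∧ (2 ≤ k s ↔ s ∈ A₂) then (1 : ℝ) else 0) =
      ∑ T ∈ A₂.powerset, ∑ T₁ ∈ T.powerset, (-1 : ℝ) ^ #T *
        (if ∀ s ∈ (S \ A₂) ∪ T, k s = (if s ∈ (A₁ \ A₂) ∪ T₁ then 1 else 0) then (1 : ℝ) else 0) := by
  -- split the pattern condition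
  rw [show (if ∀ s ∈ S, (1 ≤ k s ↔ s ∈ A₁) ∧ (2 ≤ k s ↔ s ∈ A₂) then (1 : ℝ) else 0) =
      (if (∀ s ∈ S \ A₁, k s = 0) ∧ (∀ s ∈ A₁ \ A₂, k s = 1) then (1 : ℝ) else 0) *
        (if ∀ s ∈ A₂, 2 ≤ k s then (1 : ℝ) else 0) by
    rw [ite_zero_mul_ite_zero, mul_one]
    exact if_congr (cap_pattern_iff k h₁ h₂) rfl rfl]
  -- expand `𝟙[k ≥ 2 on A₂] = ∏ (1 - g)`
  have hprod : (if ∀ s ∈ A₂, 2 ≤ k s then (1 : ℝ) else 0) =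
      ∏ s ∈ A₂, ((1 : ℝ) - ((if k s = 1 then (1 : ℝ) else 0) + (if k s = 0 then (1 : ℝ) else 0))) := by
    rw [← Finset.prod_boole]
    exact Finset.prod_congr rfl fun s _ => ite_two_le_eq (k s)
  rw [hprod, Finset.prod_sub, Finset.mul_sum]
  refine Finset.sum_congr rfl fun T hT => ?_
  rw [Finset.mem_powerset] at hT
  rw [Finset.prod_const_one, mul_one, Finset.prod_add, Finset.mul_sum, Finset.mul_sum]
  refine Finset.sum_congr rfl fun T₁ hT₁ => ?_
  rw [Finset.mem_powerset] at hT₁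
  rw [Finset.prod_boole, Finset.prod_boole, ite_zero_mul_ite_zero, mul_one, mul_left_comm, ite_zero_mul_ite_zero,
    mul_one]
  congr 1
  exact if_congr (val_pattern_iff k h₁ h₂ hT hT₁) rfl rfl

end InclusionExclusion

/-- **The capped cylinder probabilities of the `+` law as signed sums of value cylinders**
(`β ≥ 0`, `A₂ ⊆ A₁ ⊆ S`):
`plusCapLaw[capCyl S A₁ A₂] = ∑_{T ⊆ A₂} ∑_{T₁ ⊆ T} (-1)^{|T|} plusCapLaw[capCyl ((S∖A₂)∪T) ((A₁∖A₂)∪T₁) ∅]`. [cite: Raoufi2020, §2, Thm. 2] -/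
theorem plusCapLaw_real_capCyl_eq_sum (L : ℕ) {β : ℝ} (hβ : 0 ≤ β) {S A₁ A₂ : Finset (Sym2 (Site d))}
    (h₁ : A₁ ⊆ S) (h₂ : A₂ ⊆ A₁) :
    (plusCapLaw d L β).real (capCyl S A₁ A₂) =
      ∑ T ∈ A₂.powerset, ∑ T₁ ∈ T.powerset, (-1 : ℝ) ^ #T *
        (plusCapLaw d L β).real (capCyl ((S \ A₂) ∪ T) ((A₁ \ A₂) ∪ T₁) ∅) := by
  classical
  simp_rw [plusCapLaw_real_apply d L hβ]
  have hterm : ∀ n : Current (plusBoxGraph d L),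
      sourcelessWeight d β n / plusCurrentSum (plusBoxGraph d L) (boxCore d L) β ∅ *
        (if capEnc n.liftVal ∈ capCyl S A₁ A₂ then (1 : ℝ) else 0) =
      ∑ T ∈ A₂.powerset, ∑ T₁ ∈ T.powerset, (-1 : ℝ) ^ #T *
        (sourcelessWeight d β n / plusCurrentSum (plusBoxGraph d L) (boxCore d L) β ∅ *
          (if capEnc n.liftVal ∈ capCyl ((S \ A₂) ∪ T) ((A₁ \ A₂) ∪ T₁) ∅ then (1 : ℝ) else 0)) := by
    intro n
    simp_rw [capEnc_mem_capCyl_empty_iff, capEnc_mem_capCyl_iff, indicator_cap_eq_sum n.liftVal h₁ h₂, Finset.mul_sum]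
    refine Finset.sum_congr rfl fun T _ => Finset.sum_congr rfl fun T₁ _ => ?_
    ring
  simp_rw [hterm]
  have hS : ∀ T T₁, Summable fun n : Current (plusBoxGraph d L) => (-1 : ℝ) ^ #T *
      (sourcelessWeight d β n / plusCurrentSum (plusBoxGraph d L) (boxCore d L) β ∅ *
        (if capEnc n.liftVal ∈ capCyl ((S \ A₂) ∪ T) ((A₁ \ A₂) ∪ T₁) ∅ then (1 : ℝ) else 0)) := by
    intro T T₁
    exact (summable_sourcelessWeight_div_mul β _ _ fun n => abs_ite_le_one _).mul_left _
  rw [Summable.tsum_finsetSum (fun T _ => summable_sum fun T₁ _ => hS T T₁)]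
  refine Finset.sum_congr rfl fun T _ => ?_
  rw [Summable.tsum_finsetSum (fun T₁ _ => hS T T₁)]
  refine Finset.sum_congr rfl fun T₁ _ => ?_
  rw [tsum_mul_left]

/-- **The capped cylinder probabilities of the free law as signed sums of value cylinders**
(`β ≥ 0`, `A₂ ⊆ A₁ ⊆ S`). [cite: Raoufi2020, §2, Thm. 2] -/
theorem freeCapLaw_real_capCyl_eq_sum (L : ℕ) {β : ℝ} (hβ : 0 ≤ β) {S A₁ A₂ : Finset (Sym2 (Site d))}
    (h₁ : A₁ ⊆ S) (h₂ : A₂ ⊆ A₁) :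
    (freeCapLaw d L β).real (capCyl S A₁ A₂) =
      ∑ T ∈ A₂.powerset, ∑ T₁ ∈ T.powerset, (-1 : ℝ) ^ #T *
        (freeCapLaw d L β).real (capCyl ((S \ A₂) ∪ T) ((A₁ \ A₂) ∪ T₁) ∅) := by
  classical
  simp_rw [freeCapLaw_real_apply d L hβ]
  have hterm : ∀ n : Current (freeBoxGraph d L),
      sourcelessWeight d β n / plusCurrentSum (freeBoxGraph d L) (boxCore d L) β ∅ *
        (if capEnc n.liftVal ∈ capCyl S A₁ A₂ then (1 : ℝ) else 0) =
      ∑ T ∈ A₂.powerset, ∑ T₁ ∈ T.powerset, (-1 : ℝ) ^ #T *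
        (sourcelessWeight d β n / plusCurrentSum (freeBoxGraph d L) (boxCore d L) β ∅ *
          (if capEnc n.liftVal ∈ capCyl ((S \ A₂) ∪ T) ((A₁ \ A₂) ∪ T₁) ∅ then (1 : ℝ) else 0)) := by
    intro n
    simp_rw [capEnc_mem_capCyl_empty_iff, capEnc_mem_capCyl_iff, indicator_cap_eq_sum n.liftVal h₁ h₂, Finset.mul_sum]
    refine Finset.sum_congr rfl fun T _ => Finset.sum_congr rfl fun T₁ _ => ?_
    ring
  simp_rw [hterm]
  have hS : ∀ T T₁, Summable fun n : Current (freeBoxGraph d L) => (-1 : ℝ) ^ #T *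
      (sourcelessWeight d β n / plusCurrentSum (freeBoxGraph d L) (boxCore d L) β ∅ *
        (if capEnc n.liftVal ∈ capCyl ((S \ A₂) ∪ T) ((A₁ \ A₂) ∪ T₁) ∅ then (1 : ℝ) else 0)) := by
    intro T T₁
    exact (summable_sourcelessWeight_div_mul β _ _ fun n => abs_ite_le_one _).mul_left _
  rw [Summable.tsum_finsetSum (fun T _ => summable_sum fun T₁ _ => hS T T₁)]
  refine Finset.sum_congr rfl fun T _ => ?_
  rw [Summable.tsum_finsetSum (fun T₁ _ => hS T T₁)]
  refine Finset.sum_congr rfl fun T₁ _ => ?_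
  rw [tsum_mul_left]

/-! ### The summed law factorises on capped cylinders -/

section SumPattern

variable {α : Type*} [DecidableEq α]

/-- **The capped pattern of a function on `S`**: (`{s ∈ S | k s ≥ 1}`, `{s ∈ S | k s ≥ 2}`). [folklore] -/
def capPattern (S : Finset α) (k : α → ℕ) : Finset α × Finset α :=
  (S.filter fun s => 1 ≤ k s, S.filter fun s => 2 ≤ k s)

omit [DecidableEq α] in
/-- A function satisfies the pattern condition of `(B₁, B₂)` (`B₁, B₂ ⊆ S`) iff `(B₁, B₂)` is its
capped pattern. [folklore] -/
theorem cap_condition_iff_eq_capPattern (k : α → ℕ) {S : Finset α} {B : Finset α × Finset α}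
    (hB₁ : B.1 ⊆ S) (hB₂ : B.2 ⊆ S) :
    (∀ s ∈ S, (1 ≤ k s ↔ s ∈ B.1) ∧ (2 ≤ k s ↔ s ∈ B.2)) ↔ B = capPattern S k := by
  rw [Prod.ext_iff, capPattern]
  simp only
  constructor
  · intro h
    constructor
    · ext s
      rw [Finset.mem_filter]
      exact ⟨fun hs => ⟨hB₁ hs, (h s (hB₁ hs)).1.2 hs⟩, fun hs => (h s hs.1).1.1 hs.2⟩
    · ext s
      rw [Finset.mem_filter]
      exact ⟨fun hs => ⟨hB₂ hs, (h s (hB₂ hs)).2.2 hs⟩, fun hs => (h s hs.1).2.1 hs.2⟩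
  · rintro ⟨h1, h2⟩ s hs
    rw [h1, h2, Finset.mem_filter, Finset.mem_filter]
    exact ⟨⟨fun h => ⟨hs, h⟩, fun h => h.2⟩, ⟨fun h => ⟨hs, h⟩, fun h => h.2⟩⟩

omit [DecidableEq α] in
/-- The capped pattern lies in `S.powerset ×ˢ S.powerset`. [folklore] -/
theorem capPattern_mem (S : Finset α) (k : α → ℕ) : capPattern S k ∈ S.powerset ×ˢ S.powerset := by
  rw [Finset.mem_product, Finset.mem_powerset, Finset.mem_powerset, capPattern]
  exact ⟨Finset.filter_subset _ _, Finset.filter_subset _ _⟩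

/-- **The capped pattern of a sum**: `cap(k₁ + k₂)` has `≥ 1`-set `B₁ ∪ C₁` and `≥ 2`-set
`B₂ ∪ C₂ ∪ (B₁ ∩ C₁)` in terms of the patterns `(B₁,B₂)`, `(C₁,C₂)` of `k₁`, `k₂`. [folklore] -/
theorem capPattern_add (S : Finset α) (k₁ k₂ : α → ℕ) :
    capPattern S (k₁ + k₂) =
      ((capPattern S k₁).1 ∪ (capPattern S k₂).1,
        (capPattern S k₁).2 ∪ (capPattern S k₂).2 ∪ ((capPattern S k₁).1 ∩ (capPattern S k₂).1)) := by
  simp only [capPattern, Prod.mk.injEq]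
  constructor
  · ext s
    simp only [Finset.mem_filter, Pi.add_apply, Finset.mem_union]
    constructor
    · rintro ⟨hs, h⟩
      by_cases h1 : 1 ≤ k₁ s
      · exact Or.inl ⟨hs, h1⟩
      · exact Or.inr ⟨hs, by omega⟩
    · rintro (⟨hs, h⟩ | ⟨hs, h⟩) <;> exact ⟨hs, by omega⟩
  · ext s
    simp only [Finset.mem_filter, Pi.add_apply, Finset.mem_union, Finset.mem_inter]
    constructor
    · rintro ⟨hs, h⟩
      by_cases h1 : 2 ≤ k₁ s
      · exact Or.inl (Or.inl ⟨hs, h1⟩)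
      · by_cases h2 : 2 ≤ k₂ s
        · exact Or.inl (Or.inr ⟨hs, h2⟩)
        · exact Or.inr ⟨⟨hs, by omega⟩, ⟨hs, by omega⟩⟩
    · rintro ((⟨hs, h⟩ | ⟨hs, h⟩) | ⟨⟨hs, h⟩, ⟨-, h'⟩⟩) <;> exact ⟨hs, by omega⟩

/-- **The capped pattern of a sum splits uniquely**: for `A₁, A₂ ⊆ S`, the indicator of the pattern
condition of `(A₁,A₂)` for `k₁ + k₂` is the sum, over the pairs of patterns `B = (B₁,B₂)`,
`C = (C₁,C₂)` in `S` with `B₁ ∪ C₁ = A₁` and `B₂ ∪ C₂ ∪ (B₁ ∩ C₁) = A₂`, of the products of the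
indicators of the pattern conditions of `B` for `k₁` and of `C` for `k₂`. [folklore] -/
theorem indicator_cap_add_eq_sum (k₁ k₂ : α → ℕ) {S A₁ A₂ : Finset α} (hA₁ : A₁ ⊆ S) (hA₂ : A₂ ⊆ S) :
    (if ∀ s ∈ S, (1 ≤ (k₁ + k₂) s ↔ s ∈ A₁) ∧ (2 ≤ (k₁ + k₂) s ↔ s ∈ A₂) then (1 : ℝ) else 0) =
      ∑ B ∈ S.powerset ×ˢ S.powerset, ∑ C ∈ S.powerset ×ˢ S.powerset,
        if B.1 ∪ C.1 = A₁ ∧ B.2 ∪ C.2 ∪ (B.1 ∩ C.1) = A₂ then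
          (if ∀ s ∈ S, (1 ≤ k₁ s ↔ s ∈ B.1) ∧ (2 ≤ k₁ s ↔ s ∈ B.2) then (1 : ℝ) else 0) *
            (if ∀ s ∈ S, (1 ≤ k₂ s ↔ s ∈ C.1) ∧ (2 ≤ k₂ s ↔ s ∈ C.2) then (1 : ℝ) else 0) else 0 := by
  set β₁ := capPattern S k₁ with hβ₁
  set γ₁ := capPattern S k₂ with hγ₁
  have hmemS : ∀ B : Finset α × Finset α, B ∈ S.powerset ×ˢ S.powerset → B.1 ⊆ S ∧ B.2 ⊆ S := by
    intro B hB
    rw [Finset.mem_product, Finset.mem_powerset, Finset.mem_powerset] at hB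
    exact hB
  -- the summand vanishes unless `B = β₁` and `C = γ₁`
  have hvan : ∀ B ∈ S.powerset ×ˢ S.powerset, ∀ C ∈ S.powerset ×ˢ S.powerset, (B ≠ β₁ ∨ C ≠ γ₁) →
      (if B.1 ∪ C.1 = A₁ ∧ B.2 ∪ C.2 ∪ (B.1 ∩ C.1) = A₂ then
        (if ∀ s ∈ S, (1 ≤ k₁ s ↔ s ∈ B.1) ∧ (2 ≤ k₁ s ↔ s ∈ B.2) then (1 : ℝ) else 0) *
          (if ∀ s ∈ S, (1 ≤ k₂ s ↔ s ∈ C.1) ∧ (2 ≤ k₂ s ↔ s ∈ C.2) then (1 : ℝ) else 0) else 0) = 0 := by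
    intro B hB C hC hne
    by_cases h : B.1 ∪ C.1 = A₁ ∧ B.2 ∪ C.2 ∪ (B.1 ∩ C.1) = A₂
    · rw [if_pos h]
      rcases hne with hne | hne
      · rw [if_neg (fun hb => hne ((cap_condition_iff_eq_capPattern k₁ (hmemS B hB).1 (hmemS B hB).2).1 hb)),
          zero_mul]
      · rw [mul_comm, if_neg (fun hc => hne ((cap_condition_iff_eq_capPattern k₂ (hmemS C hC).1 (hmemS C hC).2).1 hc)),
          zero_mul]
    · rw [if_neg h]
  rw [Finset.sum_eq_single_of_mem β₁ (capPattern_mem S k₁) (fun B hB hne =>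
    Finset.sum_eq_zero fun C hC => hvan B hB C hC (Or.inl hne))]
  rw [Finset.sum_eq_single_of_mem γ₁ (capPattern_mem S k₂) (fun C hC hne =>
    hvan β₁ (capPattern_mem S k₁) C hC (Or.inr hne))]
  rw [if_pos ((cap_condition_iff_eq_capPattern k₁ (hmemS β₁ (capPattern_mem S k₁)).1
      (hmemS β₁ (capPattern_mem S k₁)).2).2 rfl),
    if_pos ((cap_condition_iff_eq_capPattern k₂ (hmemS γ₁ (capPattern_mem S k₂)).1
      (hmemS γ₁ (capPattern_mem S k₂)).2).2 rfl), mul_one]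
  have hL : (∀ s ∈ S, (1 ≤ (k₁ + k₂) s ↔ s ∈ A₁) ∧ (2 ≤ (k₁ + k₂) s ↔ s ∈ A₂)) ↔
      (β₁.1 ∪ γ₁.1 = A₁ ∧ β₁.2 ∪ γ₁.2 ∪ (β₁.1 ∩ γ₁.1) = A₂) := by
    rw [cap_condition_iff_eq_capPattern (k₁ + k₂) (B := (A₁, A₂)) hA₁ hA₂, capPattern_add, Prod.ext_iff]
    simp only [hβ₁, hγ₁]
    exact ⟨fun h => ⟨h.1.symm, h.2.symm⟩, fun h => ⟨h.1.symm, h.2.symm⟩⟩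
  exact if_congr hL rfl rfl

end SumPattern

open Classical in
/-- **The summed capped law factorises on capped cylinders** (Raoufi's `P⁰ ⊗ P⁺` / ADS15 (3.1) read
on capped values): for `β ≥ 0` and `A₁, A₂ ⊆ S`,
`sumCapLaw[capCyl S A₁ A₂] = ∑_{B,C patterns in S, B₁∪C₁ = A₁, B₂∪C₂∪(B₁∩C₁) = A₂} freeCapLaw[capCyl S B₁ B₂] · plusCapLaw[capCyl S C₁ C₂]`. [cite: Raoufi2020, §2, after Thm. 2] -/
theorem sumCapLaw_real_capCyl_eq_sum (L : ℕ) {β : ℝ} (hβ : 0 ≤ β) {S A₁ A₂ : Finset (Sym2 (Site d))}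
    (hA₁ : A₁ ⊆ S) (hA₂ : A₂ ⊆ S) :
    (sumCapLaw d L β).real (capCyl S A₁ A₂) =
      ∑ B ∈ S.powerset ×ˢ S.powerset, ∑ C ∈ S.powerset ×ˢ S.powerset,
        if B.1 ∪ C.1 = A₁ ∧ B.2 ∪ C.2 ∪ (B.1 ∩ C.1) = A₂ then
          (freeCapLaw d L β).real (capCyl S B.1 B.2) * (plusCapLaw d L β).real (capCyl S C.1 C.2) else 0 := by
  have hN := adsPairNorm_pos d L hβ
  rw [sumCapLaw_real_apply d L hβ]
  set f : Finset (Sym2 (Site d)) × Finset (Sym2 (Site d)) → Current (freeBoxGraph d L) → ℝ := fun B n =>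
    if capEnc n.liftVal ∈ capCyl S B.1 B.2 then sourcelessWeight d β n else 0 with hf
  set g : Finset (Sym2 (Site d)) × Finset (Sym2 (Site d)) → Current (plusBoxGraph d L) → ℝ := fun C n =>
    if capEnc n.liftVal ∈ capCyl S C.1 C.2 then sourcelessWeight d β n else 0 with hg
  have hterm : ∀ p : Current (freeBoxGraph d L) × Current (plusBoxGraph d L),
      adsPairWeight d L β p / adsPairNorm d L β *
        (if capEnc (p.1.liftVal + p.2.liftVal) ∈ capCyl S A₁ A₂ then (1 : ℝ) else 0) =
      ∑ B ∈ S.powerset ×ˢ S.powerset, ∑ C ∈ S.powerset ×ˢ S.powerset,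
        if B.1 ∪ C.1 = A₁ ∧ B.2 ∪ C.2 ∪ (B.1 ∩ C.1) = A₂ then
          (adsPairNorm d L β)⁻¹ * (f B p.1 * g C p.2) else 0 := by
    intro p
    simp_rw [capEnc_mem_capCyl_iff, indicator_cap_add_eq_sum _ _ hA₁ hA₂]
    rw [adsPairWeight_eq_mul, Finset.mul_sum]
    refine Finset.sum_congr rfl fun B _ => ?_
    rw [Finset.mul_sum]
    refine Finset.sum_congr rfl fun C _ => ?_
    by_cases h : B.1 ∪ C.1 = A₁ ∧ B.2 ∪ C.2 ∪ (B.1 ∩ C.1) = A₂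
    · rw [if_pos h, if_pos h]
      have e₁ : f B p.1 = sourcelessWeight d β p.1 * (if capEnc p.1.liftVal ∈ capCyl S B.1 B.2 then (1 : ℝ) else 0) := by
        simp only [hf]; split_ifs <;> simp
      have e₂ : g C p.2 = sourcelessWeight d β p.2 * (if capEnc p.2.liftVal ∈ capCyl S C.1 C.2 then (1 : ℝ) else 0) := by
        simp only [hg]; split_ifs <;> simp
      rw [e₁, e₂, capEnc_mem_capCyl_iff, capEnc_mem_capCyl_iff]
      simp only [sourcelessWeight]
      ring
    · rw [if_neg h, if_neg h, mul_zero]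
  simp_rw [hterm]
  -- summability
  have hfle : ∀ B n, |f B n| ≤ (n.weight β) := fun B n => by
    simp only [hf, sourcelessWeight]; split_ifs
    · rw [abs_of_nonneg (Current.weight_nonneg hβ n)]
    · rw [abs_zero]; exact Current.weight_nonneg hβ n
    · rw [abs_zero]; exact Current.weight_nonneg hβ n
  have hgle : ∀ C n, |g C n| ≤ (n.weight β) := fun C n => by
    simp only [hg, sourcelessWeight]; split_ifs
    · rw [abs_of_nonneg (Current.weight_nonneg hβ n)]
    · rw [abs_zero]; exact Current.weight_nonneg hβ n
    · rw [abs_zero]; exact Current.weight_nonneg hβ n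
  have hprodS : ∀ B C, Summable fun p : Current (freeBoxGraph d L) × Current (plusBoxGraph d L) =>
      f B p.1 * g C p.2 := by
    intro B C
    have h := (summable_currentWeight_holds (freeBoxGraph d L) β).mul_of_nonneg
      (summable_currentWeight_holds (plusBoxGraph d L) β) (fun n => Current.weight_nonneg hβ n)
      (fun n => Current.weight_nonneg hβ n)
    refine h.of_norm_bounded fun p => ?_
    rw [Real.norm_eq_abs, abs_mul]
    exact mul_le_mul (hfle B p.1) (hgle C p.2) (abs_nonneg _) (Current.weight_nonneg hβ _)
  have hS : ∀ B C, Summable fun p : Current (freeBoxGraph d L) × Current (plusBoxGraph d L) =>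
      if B.1 ∪ C.1 = A₁ ∧ B.2 ∪ C.2 ∪ (B.1 ∩ C.1) = A₂ then (adsPairNorm d L β)⁻¹ * (f B p.1 * g C p.2) else 0 := by
    intro B C
    by_cases h : B.1 ∪ C.1 = A₁ ∧ B.2 ∪ C.2 ∪ (B.1 ∩ C.1) = A₂
    · simp only [if_pos h]; exact (hprodS B C).mul_left _
    · simp only [if_neg h]; exact summable_zero
  have hfn : ∀ B, Summable fun n => ‖f B n‖ := fun B =>
    Summable.of_nonneg_of_le (fun n => norm_nonneg _) (fun n => by rw [Real.norm_eq_abs]; exact hfle B n)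
      (summable_currentWeight_holds (freeBoxGraph d L) β)
  have hgn : ∀ C, Summable fun n => ‖g C n‖ := fun C =>
    Summable.of_nonneg_of_le (fun n => norm_nonneg _) (fun n => by rw [Real.norm_eq_abs]; exact hgle C n)
      (summable_currentWeight_holds (plusBoxGraph d L) β)
  rw [Summable.tsum_finsetSum (fun B _ => summable_sum fun C _ => hS B C)]
  refine Finset.sum_congr rfl fun B _ => ?_
  rw [Summable.tsum_finsetSum (fun C _ => hS B C)]
  refine Finset.sum_congr rfl fun C _ => ?_
  by_cases h : B.1 ∪ C.1 = A₁ ∧ B.2 ∪ C.2 ∪ (B.1 ∩ C.1) = A₂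
  · simp only [if_pos h]
    have hfree : (freeCapLaw d L β).real (capCyl S B.1 B.2) =
        (∑' n, f B n) / plusCurrentSum (freeBoxGraph d L) (boxCore d L) β ∅ := by
      rw [freeCapLaw_real_apply d L hβ, tsum_div_mul_ite]
    have hplus : (plusCapLaw d L β).real (capCyl S C.1 C.2) =
        (∑' n, g C n) / plusCurrentSum (plusBoxGraph d L) (boxCore d L) β ∅ := by
      rw [plusCapLaw_real_apply d L hβ, tsum_div_mul_ite]
    have hZ₀ := plusCurrentSum_freeBoxGraph_pos (d := d) L β
    have hZ := plusCurrentSum_plusBoxGraph_pos (d := d) L β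
    rw [hfree, hplus, tsum_mul_left, ← tsum_mul_tsum_of_summable_norm (hfn B) (hgn C),
      adsPairNorm_eq_mul d L hβ]
    field_simp
  · simp only [if_neg h, tsum_zero]

end Literature.Probability.LatticeModels
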